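import Literature.Analysis.FunctionSpaces.PolchinskiHeatEquation
import HarnessLib

/-!
# The backward heat equation for the fluctuation covariances `C_∞ − C_t`
# (Bauerschmidt–Bodineau–Dagallier §3.1–3.2: the Gaussian part of `−∂_t E_{ν_t} = E_{ν_t} L_t`)

Topic `Literature/Analysis/FunctionSpaces`; fifth "proof architecture" file behind the named fact
`Polchinski.BauerschmidtBodineau_multiscaleBakryEmery` ([BBD] Theorem 3, `MultiscaleBakryEmery.lean`).
The renormalised measure is `E_{ν_t}[F] = e^{V_∞(0)} E_{C_∞−C_t}[e^{−V_t} F]` ([BBD] (e:nut-def),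
`Polchinski.renormExpect`), so the dual identity `−∂_t E_{ν_t}F = E_{ν_t}[L_tF]` of [BBD] Proposition 8
((e:polchinski-semigroup)) rests on the heat equation for the DECREASING family of fluctuation
covariances `B_t = C_∞ − C_t`: `∂_t E_{C_∞−C_t}[G(φ+ζ)] = −½ E_{C_∞−C_t}[(Δ_{Ċ_t}G)(φ+ζ)]`.  This file
proves it (Prop 5 «for all `t` such that `C_t` is differentiable», applied to `C_∞ − C_t`, whose
derivative is `−Ċ_t`), in the generality of `PolchinskiHeatEquation.lean` (possibly degenerate `Ċ_t`,
`G` bounded with bounded uniformly continuous Hessian), together with the weak continuity of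
`t ↦ E_{C_∞−C_t}[H(φ+ζ)]` on `[0,∞)` and its limit `H(φ)` as `t → ∞` (the «weak convergence of the
Gaussian measure with vanishing covariance to the Dirac measure», [BBD] proof of Prop 8, p0015 L2–3,
here for `C_∞ − C_t → 0`, which is what makes `ν_t` concentrate as `t → ∞`, cf. (e:continuity)).

## Main results (sorry-free; no new definitions, no new named facts)

* `integral_gaussian_add_sub_eq`, `abs_integral_add_sub_integral_sub_sum_le` — the two-scale
  increment `E_{A+S}G − E_AG = E_A[E_S[G(·+w)] − G]` and its second-order expansion
  `|E_{A+S}G − E_AG − ½Σ S_{ij}E_A[∂_i∂_jG]| ≤ ε trS + 2Mδ⁻²(Σ|S_{ij}|)² E‖z‖⁴` for arbitrary positive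
  semidefinite base `A` and increment `S` (generic forms of the `C_s ≤ C_{s'}` lemmas of
  `PolchinskiHeatEquation.lean`).
* `tendsto_integral_gaussian_Cinf_sub_Ici` — continuity of `t ↦ E_{C_∞−C_t}[H(φ+ζ)]` on `[0,∞)` for
  bounded uniformly continuous `H`; `tendsto_integral_gaussian_Cinf_sub_atTop` — its limit `H(φ)` at `∞`.
* `hasDerivWithinAt_integral_gaussian_Cinf_sub_Ici` / `_Iic`, **`hasDerivAt_integral_gaussian_Cinf_sub`**
  — `∂_t E_{C_∞−C_t}[G(φ+ζ)] = −½ Σ_{ij} Ċ_t^{ij} E_{C_∞−C_t}[∂_i∂_jG(φ+ζ)]` (right derivative at every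
  `t ≥ 0`, two-sided at `t > 0`).

What is NOT here: the `t`-dependence of the integrand `e^{−V_t}F` (product rule under the integral)
and hence `−∂_t E_{ν_t}F = E_{ν_t}L_tF` itself; Lemma 1; Theorem 3.  Nothing here concerns Yang–Mills.

## References

* [BauerschmidtBodineauDagallier2023] R. Bauerschmidt, T. Bodineau, B. Dagallier, Probab. Surveys 21
  (2024) 200–290, arXiv:2307.07619 — §3.1 Prop 5 p0014 L24–40, Prop 8 p0014 L77–113 and its proof
  p0015 L1–45. READ (held).
* [BauerschmidtBodineau2021SineGordonLSI] R. Bauerschmidt, T. Bodineau, CPAM 74 (2021), §2. READ (held).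
-/

noncomputable section

open MeasureTheory ProbabilityTheory Filter Topology Set
open scoped RealInnerProductSpace Matrix MatrixOrder

namespace Literature.Analysis.FunctionSpaces

namespace Polchinski

variable {N : ℕ}

section Generic

/-- `x ↦ G(φ + x)` is integrable for bounded measurable `G` and a finite measure. [folklore] -/
private theorem integrable_shift_of_bounded' {G : EuclideanSpace ℝ (Fin N) → ℝ} (hGm : Measurable G)
    {K0 : ℝ} (hG : ∀ x, |G x| ≤ K0) (P : Measure (EuclideanSpace ℝ (Fin N))) [IsFiniteMeasure P]
    (φ : EuclideanSpace ℝ (Fin N)) : Integrable (fun x => G (φ + x)) P :=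
  Integrable.of_bound (hGm.comp (measurable_const_add φ)).aestronglyMeasurable K0
    (Eventually.of_forall fun w => by simpa [Real.norm_eq_abs] using hG (φ + w))

/-- Measurability of the inner Gaussian average `x ↦ E_S[G(φ+x+w)]`. [folklore] -/
private theorem measurable_integral_shift' {G : EuclideanSpace ℝ (Fin N) → ℝ} (hGm : Measurable G)
    (P : Measure (EuclideanSpace ℝ (Fin N))) [SFinite P] (φ : EuclideanSpace ℝ (Fin N)) :
    Measurable fun x => ∫ w, G (φ + x + w) ∂P := by
  have hsm : StronglyMeasurable
      (Function.uncurry fun (x w : EuclideanSpace ℝ (Fin N)) => G (φ + x + w)) :=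
    (hGm.comp ((measurable_const_add φ).comp measurable_fst |>.add measurable_snd)).stronglyMeasurable
  exact (hsm.integral_prod_right (ν := P)).measurable

/-- `∫ (H(y+w) − H(y)) dP = (∫ H(y+w) dP) − H(y)` for a probability measure. [folklore] -/
private theorem integral_shift_sub_self' {H : EuclideanSpace ℝ (Fin N) → ℝ} (hHm : Measurable H)
    {MH : ℝ} (hH : ∀ x, |H x| ≤ MH) (P : Measure (EuclideanSpace ℝ (Fin N))) [IsProbabilityMeasure P]
    (y : EuclideanSpace ℝ (Fin N)) :
    ∫ w, (H (y + w) - H y) ∂P = (∫ w, H (y + w) ∂P) - H y := by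
  rw [integral_sub (integrable_shift_of_bounded' hHm hH P y) (integrable_const _), integral_const,
    probReal_univ, one_smul]

/-- `|D²G(x)(e_i,e_j)| ≤ ‖D²G(x)‖`, measurability and uniform continuity of the matrix elements of a
bounded uniformly continuous Hessian. [folklore] -/
private theorem eval₂_props' {D2 : EuclideanSpace ℝ (Fin N) →
      EuclideanSpace ℝ (Fin N) →L[ℝ] EuclideanSpace ℝ (Fin N) →L[ℝ] ℝ}
    {M : ℝ} (hM : ∀ x, ‖D2 x‖ ≤ M) (hUC : UniformContinuous D2) (i j : Fin N) :
    Measurable (fun x => D2 x (EuclideanSpace.single i 1) (EuclideanSpace.single j 1)) ∧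
    (∀ x, |D2 x (EuclideanSpace.single i 1) (EuclideanSpace.single j 1)| ≤ M) ∧
    UniformContinuous (fun x => D2 x (EuclideanSpace.single i 1) (EuclideanSpace.single j 1)) := by
  have hev : UniformContinuous fun L : EuclideanSpace ℝ (Fin N) →L[ℝ] EuclideanSpace ℝ (Fin N) →L[ℝ] ℝ =>
      L (EuclideanSpace.single i 1) (EuclideanSpace.single j 1) :=
    (ContinuousLinearMap.apply ℝ ℝ (EuclideanSpace.single j (1:ℝ))).uniformContinuous.comp
      (ContinuousLinearMap.apply ℝ (EuclideanSpace ℝ (Fin N) →L[ℝ] ℝ)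
        (EuclideanSpace.single i (1:ℝ))).uniformContinuous
  refine ⟨(hev.comp hUC).continuous.measurable, fun x => ?_, hev.comp hUC⟩
  rw [← Real.norm_eq_abs]
  calc ‖D2 x (EuclideanSpace.single i 1) (EuclideanSpace.single j 1)‖
      ≤ ‖D2 x (EuclideanSpace.single i 1)‖ * ‖EuclideanSpace.single j (1:ℝ)‖ :=
        ContinuousLinearMap.le_opNorm _ _
    _ ≤ ‖D2 x‖ * ‖EuclideanSpace.single i (1:ℝ)‖ * ‖EuclideanSpace.single j (1:ℝ)‖ :=
        mul_le_mul_of_nonneg_right (ContinuousLinearMap.le_opNorm _ _) (norm_nonneg _)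
    _ = ‖D2 x‖ := by simp
    _ ≤ M := hM x

/-- From metric uniform continuity: an `(ε,δ)` pair in the `‖·‖ ≤ ε` form. [folklore] -/
private theorem exists_delta_of_uniformContinuous' {X Y : Type*} [NormedAddCommGroup X]
    [NormedAddCommGroup Y] {f : X → Y} (hf : UniformContinuous f) {ε : ℝ} (hε : 0 < ε) :
    ∃ δ > 0, ∀ x y, ‖x - y‖ < δ → ‖f x - f y‖ ≤ ε := by
  obtain ⟨δ, hδ, h⟩ := Metric.uniformContinuous_iff.mp hf ε hε
  refine ⟨δ, hδ, fun x y hxy => ?_⟩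
  have h' := h (a := x) (b := y) (by rwa [dist_eq_norm])
  rw [dist_eq_norm] at h'
  exact h'.le

/-- **The increment of a Gaussian average under a positive semidefinite increment of the covariance**:
for `A, S ⪰ 0`, `E_{A+S}[G(φ+·)] − E_A[G(φ+·)] = E_A[ x ↦ E_S[G(φ+x+w) − G(φ+x)] ]` ([BBD] §3.1
(e:Gauss-conv): `P_{A+S} = P_A ∗ P_S`). [cite: BauerschmidtBodineauDagallier2023, §3.1 (e:Gauss-conv)] -/
theorem integral_gaussian_add_sub_eq {A S : Matrix (Fin N) (Fin N) ℝ} (hA : A.PosSemidef)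
    (hS : S.PosSemidef) {G : EuclideanSpace ℝ (Fin N) → ℝ} (hGm : Measurable G)
    {K0 : ℝ} (hG : ∀ x, |G x| ≤ K0) (φ : EuclideanSpace ℝ (Fin N)) :
    (∫ x, G (φ + x) ∂(multivariateGaussian 0 (A + S))) -
        ∫ x, G (φ + x) ∂(multivariateGaussian 0 A) =
      ∫ x, (∫ w, (G (φ + x + w) - G (φ + x)) ∂(multivariateGaussian 0 S))
        ∂(multivariateGaussian 0 A) := by
  rw [integral_gaussian_add_shift hA hS hGm hG φ, ← integral_sub]
  · refine integral_congr_ae (Eventually.of_forall fun x => ?_)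
    simp only
    rw [integral_shift_sub_self' hGm hG]
  · refine Integrable.of_bound (measurable_integral_shift' hGm _ φ).aestronglyMeasurable K0
      (Eventually.of_forall fun x => ?_)
    have h := norm_integral_le_of_norm_le_const
      (μ := multivariateGaussian 0 S) (f := fun w => G (φ + x + w)) (C := K0)
      (Eventually.of_forall fun w => by simpa [Real.norm_eq_abs] using hG (φ + x + w))
    simpa using h
  · exact integrable_shift_of_bounded' hGm hG _ φ

/-- **Second-order expansion of a Gaussian average under a positive semidefinite covariance increment**:
for `A, S ⪰ 0` and `G` bounded with bounded, `(ε,δ)`-uniformly continuous Hessian,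
`|E_{A+S}[G(φ+·)] − E_A[G(φ+·)] − ½ Σ_{ij} S_{ij} E_A[∂_i∂_jG(φ+·)]| ≤ ε trS + 2Mδ⁻²(Σ_{ij}|S_{ij}|)² E‖z‖⁴`
(the two-scale form of [BBD] Prop 5, arbitrary base). [cite: BauerschmidtBodineauDagallier2023, Proposition 5 (proof)] -/
theorem abs_integral_add_sub_integral_sub_sum_le {G : EuclideanSpace ℝ (Fin N) → ℝ}
    {D1 : EuclideanSpace ℝ (Fin N) → EuclideanSpace ℝ (Fin N) →L[ℝ] ℝ}
    {D2 : EuclideanSpace ℝ (Fin N) → EuclideanSpace ℝ (Fin N) →L[ℝ] EuclideanSpace ℝ (Fin N) →L[ℝ] ℝ}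
    (h1 : ∀ x, HasFDerivAt G (D1 x) x) (h2 : ∀ x, HasFDerivAt D1 (D2 x) x)
    {K0 : ℝ} (hG : ∀ x, |G x| ≤ K0) {M : ℝ} (hM : ∀ x, ‖D2 x‖ ≤ M) (hUC : UniformContinuous D2)
    {ε δ : ℝ} (hδ : 0 < δ) (hUCδ : ∀ x y, ‖x - y‖ < δ → ‖D2 x - D2 y‖ ≤ ε)
    {A S : Matrix (Fin N) (Fin N) ℝ} (hA : A.PosSemidef) (hS : S.PosSemidef)
    (φ : EuclideanSpace ℝ (Fin N)) :
    |(∫ x, G (φ + x) ∂(multivariateGaussian 0 (A + S))) -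
        (∫ x, G (φ + x) ∂(multivariateGaussian 0 A)) -
        (1 / 2) * ∑ i, ∑ j, S i j *
          ∫ x, D2 (φ + x) (EuclideanSpace.single i 1) (EuclideanSpace.single j 1)
            ∂(multivariateGaussian 0 A)| ≤
      ε * ∑ i, S i i + 2 * M / δ ^ 2 * ((∑ i, ∑ j, |S i j|) ^ 2 *
        ∫ z, ‖z‖ ^ 4 ∂(stdGaussian (EuclideanSpace ℝ (Fin N)))) := by
  set P := multivariateGaussian 0 A with hP
  have hGc : Continuous G := continuous_iff_continuousAt.2 fun x => (h1 x).continuousAt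
  have hGm : Measurable G := hGc.measurable
  rw [integral_gaussian_add_sub_eq hA hS hGm hG φ]
  have hQint : ∀ i j, Integrable (fun x => D2 (φ + x) (EuclideanSpace.single i 1)
      (EuclideanSpace.single j 1)) P := by
    intro i j
    obtain ⟨hm, hb, -⟩ := eval₂_props' hM hUC i j
    exact integrable_shift_of_bounded' hm hb P φ
  have hsum : (1 / 2) * ∑ i, ∑ j, S i j * ∫ x, D2 (φ + x) (EuclideanSpace.single i 1)
      (EuclideanSpace.single j 1) ∂P =
      ∫ x, (1 / 2) * ∑ i, ∑ j, S i j * D2 (φ + x) (EuclideanSpace.single i 1)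
        (EuclideanSpace.single j 1) ∂P := by
    rw [integral_const_mul]
    congr 1
    rw [integral_finsetSum _ fun i _ => integrable_finsetSum _ fun j _ => (hQint i j).const_mul _]
    refine Finset.sum_congr rfl fun i _ => ?_
    rw [integral_finsetSum _ fun j _ => (hQint i j).const_mul _]
    refine Finset.sum_congr rfl fun j _ => ?_
    rw [integral_const_mul]
  have hQ : Integrable (fun x => (1 / 2) * ∑ i, ∑ j, S i j * D2 (φ + x) (EuclideanSpace.single i 1)
      (EuclideanSpace.single j 1)) P :=
    (integrable_finsetSum _ fun i _ => integrable_finsetSum _ fun j _ =>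
      (hQint i j).const_mul _).const_mul _
  have hJ : Integrable (fun x => ∫ w, (G (φ + x + w) - G (φ + x))
      ∂(multivariateGaussian 0 S)) P := by
    have hJ' : (fun x => ∫ w, (G (φ + x + w) - G (φ + x)) ∂(multivariateGaussian 0 S)) =
        fun x => (∫ w, G (φ + x + w) ∂(multivariateGaussian 0 S)) - G (φ + x) := by
      funext x
      rw [integral_shift_sub_self' hGm hG]
    rw [hJ']
    refine Integrable.sub ?_ (integrable_shift_of_bounded' hGm hG _ φ)
    refine Integrable.of_bound (measurable_integral_shift' hGm _ φ).aestronglyMeasurable K0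
      (Eventually.of_forall fun x => ?_)
    have h := norm_integral_le_of_norm_le_const
      (μ := multivariateGaussian 0 S) (f := fun w => G (φ + x + w)) (C := K0)
      (Eventually.of_forall fun w => by simpa [Real.norm_eq_abs] using hG (φ + x + w))
    simpa using h
  rw [hsum, ← integral_sub hJ hQ]
  have hpt : ∀ x, |(∫ w, (G (φ + x + w) - G (φ + x)) ∂(multivariateGaussian 0 S)) -
      (1 / 2) * ∑ i, ∑ j, S i j * D2 (φ + x) (EuclideanSpace.single i 1)
        (EuclideanSpace.single j 1)| ≤
      ε * ∑ i, S i i + 2 * M / δ ^ 2 * ((∑ i, ∑ j, |S i j|) ^ 2 *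
        ∫ z, ‖z‖ ^ 4 ∂(stdGaussian (EuclideanSpace ℝ (Fin N)))) :=
    fun x => abs_integral_sub_sub_half_sum_le h1 h2 hG hM hδ hUCδ hS (φ + x)
  have h := norm_integral_le_of_norm_le_const (μ := P)
    (f := fun x => (∫ w, (G (φ + x + w) - G (φ + x)) ∂(multivariateGaussian 0 S)) -
      (1 / 2) * ∑ i, ∑ j, S i j * D2 (φ + x) (EuclideanSpace.single i 1)
        (EuclideanSpace.single j 1))
    (C := ε * ∑ i, S i i + 2 * M / δ ^ 2 * ((∑ i, ∑ j, |S i j|) ^ 2 *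
        ∫ z, ‖z‖ ^ 4 ∂(stdGaussian (EuclideanSpace ℝ (Fin N)))))
    (Eventually.of_forall fun x => by rw [Real.norm_eq_abs]; exact hpt x)
  rw [Real.norm_eq_abs, probReal_univ, mul_one] at h
  exact h

/-- **Weak continuity bound**: for `A, S ⪰ 0` and `H` bounded measurable `(ε,δ)`-uniformly continuous,
`|E_{A+S}[H(φ+·)] − E_A[H(φ+·)]| ≤ ε + 2M_H δ⁻² trS`. [cite: BauerschmidtBodineauDagallier2023, Proposition 8 (proof)] -/
theorem abs_integral_add_sub_integral_le {H : EuclideanSpace ℝ (Fin N) → ℝ} (hHm : Measurable H)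
    {MH : ℝ} (hH : ∀ x, |H x| ≤ MH) {ε δ : ℝ} (hδ : 0 < δ)
    (hUCδ : ∀ x y, ‖x - y‖ < δ → |H x - H y| ≤ ε)
    {A S : Matrix (Fin N) (Fin N) ℝ} (hA : A.PosSemidef) (hS : S.PosSemidef)
    (φ : EuclideanSpace ℝ (Fin N)) :
    |(∫ x, H (φ + x) ∂(multivariateGaussian 0 (A + S))) -
        ∫ x, H (φ + x) ∂(multivariateGaussian 0 A)| ≤ ε + 2 * MH / δ ^ 2 * ∑ i, S i i := by
  rw [integral_gaussian_add_sub_eq hA hS hHm hH φ]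
  have hpt : ∀ x, |∫ w, (H (φ + x + w) - H (φ + x)) ∂(multivariateGaussian 0 S)| ≤
      ε + 2 * MH / δ ^ 2 * ∑ i, S i i := by
    intro x
    rw [integral_shift_sub_self' hHm hH]
    exact abs_integral_shift_sub_le hHm hH hδ hUCδ hS (φ + x)
  have h := norm_integral_le_of_norm_le_const (μ := multivariateGaussian 0 A)
    (f := fun x => ∫ w, (H (φ + x + w) - H (φ + x)) ∂(multivariateGaussian 0 S))
    (C := ε + 2 * MH / δ ^ 2 * ∑ i, S i i)
    (Eventually.of_forall fun x => by rw [Real.norm_eq_abs]; exact hpt x)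
  rw [Real.norm_eq_abs, probReal_univ, mul_one] at h
  exact h

end Generic

section Fluctuation

variable (D : CovDecomposition N)

/-- `C_∞ − C_s = (C_∞ − C_t) + (C_t − C_s)`. [folklore] -/
private theorem Cinf_sub_eq_add (s t : ℝ) :
    D.Cinf - D.C s = (D.Cinf - D.C t) + (D.C t - D.C s) :=
  (sub_add_sub_cancel _ _ _).symm

/-- **Weak continuity of the fluctuation averages `t ↦ E_{C_∞−C_t}[H(φ+ζ)]` on `[0,∞)`** for `H`
bounded, measurable and uniformly continuous (the fluctuation-covariance counterpart of the
continuity in the scale parameter used in [BBD] §3.2, proof of Prop 8).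
[cite: BauerschmidtBodineauDagallier2023, Proposition 8 (proof)] -/
theorem tendsto_integral_gaussian_Cinf_sub_Ici {H : EuclideanSpace ℝ (Fin N) → ℝ} (hHm : Measurable H)
    {MH : ℝ} (hH : ∀ x, |H x| ≤ MH) (hUC : UniformContinuous H) {t : ℝ} (ht : 0 ≤ t)
    (φ : EuclideanSpace ℝ (Fin N)) :
    Tendsto (fun r => ∫ x, H (φ + x) ∂(multivariateGaussian 0 (D.Cinf - D.C r))) (𝓝[Ici 0] t)
      (𝓝 (∫ x, H (φ + x) ∂(multivariateGaussian 0 (D.Cinf - D.C t)))) := by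
  have hMH0 : 0 ≤ MH := le_trans (abs_nonneg _) (hH φ)
  rw [Metric.tendsto_nhds]
  intro ε₀ hε₀
  obtain ⟨δ, hδ, hUCδ⟩ := exists_delta_of_uniformContinuous' (X := EuclideanSpace ℝ (Fin N))
    (Y := ℝ) hUC (half_pos hε₀)
  have hUCδ' : ∀ x y, ‖x - y‖ < δ → |H x - H y| ≤ ε₀ / 2 := fun x y hxy => by
    rw [← Real.norm_eq_abs]; exact hUCδ x y hxy
  have key : ∀ r, 0 ≤ r →
      |(∫ x, H (φ + x) ∂(multivariateGaussian 0 (D.Cinf - D.C r))) -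
          ∫ x, H (φ + x) ∂(multivariateGaussian 0 (D.Cinf - D.C t))| ≤
        ε₀ / 2 + 2 * MH / δ ^ 2 * |∑ i, (D.C r i i - D.C t i i)| := by
    intro r hr
    rcases le_total t r with htr | hrt
    · -- `t ≤ r`: `C_∞ − C_t = (C_∞ − C_r) + (C_r − C_t)`, base `C_∞ − C_r`
      rw [abs_sub_comm, Cinf_sub_eq_add D t r]
      refine (abs_integral_add_sub_integral_le hHm hH hδ hUCδ' (D.posSemidef_Cinf_sub hr)
        (D.posSemidef_C_sub ht htr) φ).trans ?_
      have e : ∑ i, (D.C r - D.C t) i i = ∑ i, (D.C r i i - D.C t i i) :=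
        Finset.sum_congr rfl fun i _ => by simp [Matrix.sub_apply]
      rw [e]
      gcongr
      exact le_abs_self _
    · -- `r ≤ t`: `C_∞ − C_r = (C_∞ − C_t) + (C_t − C_r)`, base `C_∞ − C_t`
      rw [Cinf_sub_eq_add D r t]
      refine (abs_integral_add_sub_integral_le hHm hH hδ hUCδ' (D.posSemidef_Cinf_sub ht)
        (D.posSemidef_C_sub hr hrt) φ).trans ?_
      have e : ∑ i, (D.C t - D.C r) i i = -∑ i, (D.C r i i - D.C t i i) := by
        rw [← Finset.sum_neg_distrib]
        exact Finset.sum_congr rfl fun i _ => by simp [Matrix.sub_apply]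
      rw [e]
      gcongr
      exact neg_le_abs _
  have htr : Tendsto (fun r => 2 * MH / δ ^ 2 * |∑ i, (D.C r i i - D.C t i i)|) (𝓝[Ici 0] t)
      (𝓝 0) := by
    have h0 : ∀ i, Tendsto (fun r => D.C r i i - D.C t i i) (𝓝[Ici 0] t) (𝓝 0) := by
      intro i
      have h := (D.hasDerivAt_C t ht i i).continuousAt.tendsto.sub_const (D.C t i i)
      rw [sub_self] at h
      exact h.mono_left nhdsWithin_le_nhds
    have h := ((tendsto_finsetSum (Finset.univ : Finset (Fin N)) fun i _ => h0 i).abs).const_mul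
      (2 * MH / δ ^ 2)
    simpa using h
  have ev1 : ∀ᶠ r in 𝓝[Ici 0] t, 2 * MH / δ ^ 2 * |∑ i, (D.C r i i - D.C t i i)| < ε₀ / 2 :=
    (tendsto_order.1 htr).2 _ (half_pos hε₀)
  have ev2 : ∀ᶠ r in 𝓝[Ici 0] t, r ∈ Ici (0:ℝ) := self_mem_nhdsWithin
  filter_upwards [ev1, ev2] with r hr1 hr2
  rw [Real.dist_eq]
  calc |(∫ x, H (φ + x) ∂(multivariateGaussian 0 (D.Cinf - D.C r))) -
        ∫ x, H (φ + x) ∂(multivariateGaussian 0 (D.Cinf - D.C t))|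
      ≤ ε₀ / 2 + 2 * MH / δ ^ 2 * |∑ i, (D.C r i i - D.C t i i)| := key r hr2
    _ < ε₀ / 2 + ε₀ / 2 := by gcongr
    _ = ε₀ := by ring

/-- **The fluctuation averages concentrate as `t → ∞`**: `E_{C_∞−C_t}[H(φ+ζ)] → H(φ)` for `H` bounded,
measurable and uniformly continuous, since `C_∞ − C_t → 0` («the weak convergence of the Gaussian
measure» with vanishing covariance «to the Dirac measure at 0», [BBD] proof of Prop 8; this is the
mechanism behind the continuity assumption (e:continuity) at `t = ∞`).
[cite: BauerschmidtBodineauDagallier2023, Proposition 8 (proof)] -/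
theorem tendsto_integral_gaussian_Cinf_sub_atTop {H : EuclideanSpace ℝ (Fin N) → ℝ}
    (hHm : Measurable H) {MH : ℝ} (hH : ∀ x, |H x| ≤ MH) (hUC : UniformContinuous H)
    (φ : EuclideanSpace ℝ (Fin N)) :
    Tendsto (fun t => ∫ x, H (φ + x) ∂(multivariateGaussian 0 (D.Cinf - D.C t))) atTop
      (𝓝 (H φ)) := by
  have hMH0 : 0 ≤ MH := le_trans (abs_nonneg _) (hH φ)
  rw [Metric.tendsto_nhds]
  intro ε₀ hε₀
  obtain ⟨δ, hδ, hUCδ⟩ := exists_delta_of_uniformContinuous' (X := EuclideanSpace ℝ (Fin N))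
    (Y := ℝ) hUC (half_pos hε₀)
  have hUCδ' : ∀ x y, ‖x - y‖ < δ → |H x - H y| ≤ ε₀ / 2 := fun x y hxy => by
    rw [← Real.norm_eq_abs]; exact hUCδ x y hxy
  have htr : Tendsto (fun t => 2 * MH / δ ^ 2 * ∑ i, (D.Cinf - D.C t) i i) atTop (𝓝 0) := by
    have h0 : ∀ i, Tendsto (fun t => (D.Cinf - D.C t) i i) atTop (𝓝 0) := by
      intro i
      have h := (D.tendsto_C i i).const_sub (D.Cinf i i)
      rw [sub_self] at h
      simpa [Matrix.sub_apply] using h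
    have h := (tendsto_finsetSum (Finset.univ : Finset (Fin N)) fun i _ => h0 i).const_mul
      (2 * MH / δ ^ 2)
    simpa using h
  have ev1 : ∀ᶠ t in atTop, 2 * MH / δ ^ 2 * ∑ i, (D.Cinf - D.C t) i i < ε₀ / 2 :=
    (tendsto_order.1 htr).2 _ (half_pos hε₀)
  filter_upwards [ev1, eventually_ge_atTop (0:ℝ)] with t ht1 ht0
  rw [Real.dist_eq]
  calc |(∫ x, H (φ + x) ∂(multivariateGaussian 0 (D.Cinf - D.C t))) - H φ|
      ≤ ε₀ / 2 + 2 * MH / δ ^ 2 * ∑ i, (D.Cinf - D.C t) i i :=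
        abs_integral_shift_sub_le hHm hH hδ hUCδ' (D.posSemidef_Cinf_sub ht0) φ
    _ < ε₀ / 2 + ε₀ / 2 := by gcongr
    _ = ε₀ := by ring

/-- **Backward heat equation for the fluctuation covariance — right derivative** at `t ≥ 0`:
for `G` bounded with bounded uniformly continuous Hessian,
`d/ds E_{C_∞−C_s}[G(φ+ζ)] |_{s=t⁺} = −½ Σ_{ij} Ċ_t^{ij} E_{C_∞−C_t}[∂_i∂_jG(φ+ζ)]` ([BBD] Prop 5 for the
decreasing family `C_∞ − C_t`; the expansion is based at the moving covariance `C_∞ − C_r`, `r ↓ t`,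
and closed by `tendsto_integral_gaussian_Cinf_sub_Ici`).
[cite: BauerschmidtBodineauDagallier2023, Proposition 5] -/
theorem hasDerivWithinAt_integral_gaussian_Cinf_sub_Ici {G : EuclideanSpace ℝ (Fin N) → ℝ}
    {D1 : EuclideanSpace ℝ (Fin N) → EuclideanSpace ℝ (Fin N) →L[ℝ] ℝ}
    {D2 : EuclideanSpace ℝ (Fin N) → EuclideanSpace ℝ (Fin N) →L[ℝ] EuclideanSpace ℝ (Fin N) →L[ℝ] ℝ}
    (h1 : ∀ x, HasFDerivAt G (D1 x) x) (h2 : ∀ x, HasFDerivAt D1 (D2 x) x)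
    {K0 : ℝ} (hG : ∀ x, |G x| ≤ K0) {M : ℝ} (hM : ∀ x, ‖D2 x‖ ≤ M) (hUC : UniformContinuous D2)
    {t : ℝ} (ht : 0 ≤ t) (φ : EuclideanSpace ℝ (Fin N)) :
    HasDerivWithinAt (fun s => ∫ x, G (φ + x) ∂(multivariateGaussian 0 (D.Cinf - D.C s)))
      (-((1 / 2) * ∑ i, ∑ j, D.Cdot t i j *
        ∫ x, D2 (φ + x) (EuclideanSpace.single i 1) (EuclideanSpace.single j 1)
          ∂(multivariateGaussian 0 (D.Cinf - D.C t)))) (Ici t) t := by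
  rw [← hasDerivWithinAt_Ioi_iff_Ici,
    hasDerivWithinAt_iff_tendsto_slope' (show t ∉ Ioi t from fun h => lt_irrefl t h)]
  set e : Fin N → EuclideanSpace ℝ (Fin N) := fun i => EuclideanSpace.single i 1 with he
  set u : ℝ → ℝ := fun s => ∫ x, G (φ + x) ∂(multivariateGaussian 0 (D.Cinf - D.C s)) with hu
  set Ir : ℝ → Fin N → Fin N → ℝ := fun r i j =>
    ∫ x, D2 (φ + x) (e i) (e j) ∂(multivariateGaussian 0 (D.Cinf - D.C r)) with hIr
  set L : ℝ := (1 / 2) * ∑ i, ∑ j, D.Cdot t i j * Ir t i j with hL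
  set σ : ℝ → Fin N → Fin N → ℝ := fun r i j => (D.C r i j - D.C t i j) / (r - t) with hσ
  set K4 : ℝ := ∫ z, ‖z‖ ^ 4 ∂(stdGaussian (EuclideanSpace ℝ (Fin N))) with hK4
  have hF : 𝓝[>] t ≤ 𝓝[Ici 0] t := nhdsWithin_mono t fun r (hr : t < r) => (ht.trans hr.le : 0 ≤ r)
  -- limits of the covariance slopes and of the moving Hessian averages
  have hσt : ∀ i j, Tendsto (fun r => σ r i j) (𝓝[>] t) (𝓝 (D.Cdot t i j)) := by
    intro i j
    have h := (D.hasDerivAt_C t ht i j).tendsto_slope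
    have h' := h.mono_left (nhdsWithin_mono t (fun r (hr : t < r) =>
      Set.mem_compl_singleton_iff.2 hr.ne'))
    have hfun : (fun r => σ r i j) = slope (fun s => D.C s i j) t := by
      funext r; simp only [hσ, slope_def_field]
    rw [hfun]
    exact h'
  have hIt : ∀ i j, Tendsto (fun r => Ir r i j) (𝓝[>] t) (𝓝 (Ir t i j)) := by
    intro i j
    obtain ⟨hm, hb, huc⟩ := eval₂_props' hM hUC i j
    exact (tendsto_integral_gaussian_Cinf_sub_Ici D hm hb huc ht φ).mono_left hF
  have hA : Tendsto (fun r => (1 / 2) * ∑ i, ∑ j, σ r i j * Ir r i j) (𝓝[>] t) (𝓝 L) :=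
    (tendsto_finsetSum _ fun i _ => tendsto_finsetSum _ fun j _ =>
      (hσt i j).mul (hIt i j)).const_mul _
  have hdiag : Tendsto (fun r => ∑ i, σ r i i) (𝓝[>] t) (𝓝 (∑ i, D.Cdot t i i)) :=
    tendsto_finsetSum _ fun i _ => hσt i i
  have hσabs : Tendsto (fun r => ∑ i, ∑ j, |σ r i j|) (𝓝[>] t) (𝓝 (∑ i, ∑ j, |D.Cdot t i j|)) :=
    tendsto_finsetSum _ fun i _ => tendsto_finsetSum _ fun j _ => (hσt i j).abs
  have hSabs : Tendsto (fun r => ∑ i, ∑ j, |D.C r i j - D.C t i j|) (𝓝[>] t) (𝓝 0) := by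
    have h0 : ∀ i j, Tendsto (fun r => |D.C r i j - D.C t i j|) (𝓝[>] t) (𝓝 0) := by
      intro i j
      have h := ((D.hasDerivAt_C t ht i j).continuousAt.tendsto.sub_const (D.C t i j)).abs
      rw [sub_self, abs_zero] at h
      exact h.mono_left nhdsWithin_le_nhds
    have h := tendsto_finsetSum (Finset.univ : Finset (Fin N)) fun i _ =>
      tendsto_finsetSum (Finset.univ : Finset (Fin N)) fun j _ => h0 i j
    simpa using h
  -- the ε-argument
  rw [Metric.tendsto_nhds]
  intro ε₀ hε₀
  set T : ℝ := ∑ i, |D.Cdot t i i| + 1 with hT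
  have hT0 : 0 < T := by positivity
  have hTlt : ∑ i, D.Cdot t i i < T := by
    have : ∑ i, D.Cdot t i i ≤ ∑ i, |D.Cdot t i i| := Finset.sum_le_sum fun i _ => le_abs_self _
    linarith
  set ε₁ : ℝ := ε₀ / (4 * T) with hε₁
  have hε₁0 : 0 < ε₁ := by positivity
  obtain ⟨δ, hδ, hUCδ⟩ := exists_delta_of_uniformContinuous' (X := EuclideanSpace ℝ (Fin N))
    (Y := EuclideanSpace ℝ (Fin N) →L[ℝ] EuclideanSpace ℝ (Fin N) →L[ℝ] ℝ) hUC hε₁0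
  have hM0 : 0 ≤ M := le_trans (norm_nonneg (D2 φ)) (hM φ)
  have hK40 : 0 ≤ K4 := integral_nonneg fun z => by positivity
  have ev1 : ∀ᶠ r in 𝓝[>] t, dist ((1 / 2) * ∑ i, ∑ j, σ r i j * Ir r i j) L < ε₀ / 4 :=
    Metric.tendsto_nhds.mp hA _ (by positivity)
  have ev2 : ∀ᶠ r in 𝓝[>] t, ∑ i, σ r i i < T := (tendsto_order.1 hdiag).2 T hTlt
  have ev3 : ∀ᶠ r in 𝓝[>] t,
      2 * M / δ ^ 2 * K4 * ((∑ i, ∑ j, |D.C r i j - D.C t i j|) * ∑ i, ∑ j, |σ r i j|) < ε₀ / 4 := by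
    have h := (hSabs.mul hσabs).const_mul (2 * M / δ ^ 2 * K4)
    rw [zero_mul, mul_zero] at h
    exact (tendsto_order.1 h).2 _ (by positivity)
  have ev4 : ∀ᶠ r in 𝓝[>] t, t < r := self_mem_nhdsWithin
  filter_upwards [ev1, ev2, ev3, ev4] with r hr1 hr2 hr3 hr4
  have hr0 : 0 ≤ r := ht.trans hr4.le
  have hh : 0 < r - t := sub_pos.2 hr4
  -- the two-scale expansion: `C_∞ − C_t = (C_∞ − C_r) + (C_r − C_t)`, base `C_∞ − C_r`
  have hE := abs_integral_add_sub_integral_sub_sum_le h1 h2 hG hM hUC hδ hUCδ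
    (D.posSemidef_Cinf_sub hr0) (D.posSemidef_C_sub ht hr4.le) φ
  rw [← Cinf_sub_eq_add D t r] at hE
  have hSσ : ∀ i j, (D.C r - D.C t) i j = (r - t) * σ r i j := by
    intro i j
    simp only [Matrix.sub_apply, hσ]
    rw [mul_div_cancel₀ _ hh.ne']
  have ha : ∑ i, (D.C r - D.C t) i i = (r - t) * ∑ i, σ r i i := by
    rw [Finset.mul_sum]; exact Finset.sum_congr rfl fun i _ => hSσ i i
  have hb : ∑ i, ∑ j, |(D.C r - D.C t) i j| = (r - t) * ∑ i, ∑ j, |σ r i j| := by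
    rw [Finset.mul_sum]
    refine Finset.sum_congr rfl fun i _ => ?_
    rw [Finset.mul_sum]
    refine Finset.sum_congr rfl fun j _ => ?_
    rw [hSσ, abs_mul, abs_of_pos hh]
  have hb' : ∑ i, ∑ j, |(D.C r - D.C t) i j| = ∑ i, ∑ j, |D.C r i j - D.C t i j| := by
    simp only [Matrix.sub_apply]
  have hquad : (1 / 2) * ∑ i, ∑ j, (D.C r - D.C t) i j * Ir r i j =
      (r - t) * ((1 / 2) * ∑ i, ∑ j, σ r i j * Ir r i j) := by
    simp_rw [hSσ]
    rw [Finset.mul_sum, Finset.mul_sum, Finset.mul_sum]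
    refine Finset.sum_congr rfl fun i _ => ?_
    rw [Finset.mul_sum, Finset.mul_sum, Finset.mul_sum]
    refine Finset.sum_congr rfl fun j _ => ?_
    ring
  -- assemble
  rw [slope_def_field, Real.dist_eq]
  set Δ := u t - u r - (1 / 2) * ∑ i, ∑ j, (D.C r - D.C t) i j * Ir r i j with hΔ
  set A := (1 / 2) * ∑ i, ∑ j, σ r i j * Ir r i j with hAdef
  have hq : (u r - u t) / (r - t) - -L = -(Δ / (r - t)) + (L - A) := by
    rw [hΔ, hquad]
    field_simp
    ring
  have hΔle : |Δ| / (r - t) ≤ ε₁ * ∑ i, σ r i i +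
      2 * M / δ ^ 2 * K4 * ((∑ i, ∑ j, |D.C r i j - D.C t i j|) * ∑ i, ∑ j, |σ r i j|) := by
    rw [div_le_iff₀ hh]
    have hE' : |Δ| ≤ ε₁ * ((r - t) * ∑ i, σ r i i) +
        2 * M / δ ^ 2 * (((r - t) * ∑ i, ∑ j, |σ r i j|) *
          (∑ i, ∑ j, |D.C r i j - D.C t i j|) * K4) := by
      have h := hE
      rw [ha] at h
      calc |Δ| ≤ ε₁ * ((r - t) * ∑ i, σ r i i) +
            2 * M / δ ^ 2 * ((∑ i, ∑ j, |(D.C r - D.C t) i j|) ^ 2 * K4) := h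
        _ = _ := by rw [pow_two, hb, ← hb, hb']; ring_nf
    calc |Δ| ≤ _ := hE'
      _ = _ := by ring
  have hA' : |L - A| < ε₀ / 4 := by rwa [Real.dist_eq, abs_sub_comm] at hr1
  calc |(u r - u t) / (r - t) - -L| = |-(Δ / (r - t)) + (L - A)| := by rw [hq]
    _ ≤ |-(Δ / (r - t))| + |L - A| := abs_add_le _ _
    _ = |Δ| / (r - t) + |L - A| := by rw [abs_neg, abs_div, abs_of_pos hh]
    _ ≤ ε₁ * ∑ i, σ r i i +
        2 * M / δ ^ 2 * K4 * ((∑ i, ∑ j, |D.C r i j - D.C t i j|) * ∑ i, ∑ j, |σ r i j|) +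
        |L - A| := by gcongr
    _ < ε₁ * T + ε₀ / 4 + ε₀ / 4 := by gcongr
    _ = ε₀ / 4 + ε₀ / 4 + ε₀ / 4 := by rw [hε₁]; field_simp
    _ < ε₀ := by linarith

/-- **Backward heat equation for the fluctuation covariance — left derivative** at `t > 0` (same
setting; now `C_∞ − C_r = (C_∞ − C_t) + (C_t − C_r)` for `r ↑ t`, base `C_∞ − C_t` fixed).
[cite: BauerschmidtBodineauDagallier2023, Proposition 5] -/
theorem hasDerivWithinAt_integral_gaussian_Cinf_sub_Iic {G : EuclideanSpace ℝ (Fin N) → ℝ}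
    {D1 : EuclideanSpace ℝ (Fin N) → EuclideanSpace ℝ (Fin N) →L[ℝ] ℝ}
    {D2 : EuclideanSpace ℝ (Fin N) → EuclideanSpace ℝ (Fin N) →L[ℝ] EuclideanSpace ℝ (Fin N) →L[ℝ] ℝ}
    (h1 : ∀ x, HasFDerivAt G (D1 x) x) (h2 : ∀ x, HasFDerivAt D1 (D2 x) x)
    {K0 : ℝ} (hG : ∀ x, |G x| ≤ K0) {M : ℝ} (hM : ∀ x, ‖D2 x‖ ≤ M) (hUC : UniformContinuous D2)
    {t : ℝ} (ht : 0 < t) (φ : EuclideanSpace ℝ (Fin N)) :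
    HasDerivWithinAt (fun s => ∫ x, G (φ + x) ∂(multivariateGaussian 0 (D.Cinf - D.C s)))
      (-((1 / 2) * ∑ i, ∑ j, D.Cdot t i j *
        ∫ x, D2 (φ + x) (EuclideanSpace.single i 1) (EuclideanSpace.single j 1)
          ∂(multivariateGaussian 0 (D.Cinf - D.C t)))) (Iic t) t := by
  rw [← hasDerivWithinAt_Iio_iff_Iic,
    hasDerivWithinAt_iff_tendsto_slope' (show t ∉ Iio t from fun h => lt_irrefl t h)]
  set e : Fin N → EuclideanSpace ℝ (Fin N) := fun i => EuclideanSpace.single i 1 with he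
  set u : ℝ → ℝ := fun s => ∫ x, G (φ + x) ∂(multivariateGaussian 0 (D.Cinf - D.C s)) with hu
  set I : Fin N → Fin N → ℝ := fun i j =>
    ∫ x, D2 (φ + x) (e i) (e j) ∂(multivariateGaussian 0 (D.Cinf - D.C t)) with hI
  set L : ℝ := (1 / 2) * ∑ i, ∑ j, D.Cdot t i j * I i j with hL
  set σ : ℝ → Fin N → Fin N → ℝ := fun r i j => (D.C r i j - D.C t i j) / (r - t) with hσ
  set K4 : ℝ := ∫ z, ‖z‖ ^ 4 ∂(stdGaussian (EuclideanSpace ℝ (Fin N))) with hK4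
  have hσt : ∀ i j, Tendsto (fun r => σ r i j) (𝓝[<] t) (𝓝 (D.Cdot t i j)) := by
    intro i j
    have h := (D.hasDerivAt_C t ht.le i j).tendsto_slope
    have h' := h.mono_left (nhdsWithin_mono t (fun r (hr : r < t) =>
      Set.mem_compl_singleton_iff.2 hr.ne))
    have hfun : (fun r => σ r i j) = slope (fun s => D.C s i j) t := by
      funext r; simp only [hσ, slope_def_field]
    rw [hfun]
    exact h'
  have hA : Tendsto (fun r => (1 / 2) * ∑ i, ∑ j, σ r i j * I i j) (𝓝[<] t) (𝓝 L) :=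
    (tendsto_finsetSum _ fun i _ => tendsto_finsetSum _ fun j _ =>
      (hσt i j).mul_const _).const_mul _
  have hdiag : Tendsto (fun r => ∑ i, σ r i i) (𝓝[<] t) (𝓝 (∑ i, D.Cdot t i i)) :=
    tendsto_finsetSum _ fun i _ => hσt i i
  have hσabs : Tendsto (fun r => ∑ i, ∑ j, |σ r i j|) (𝓝[<] t) (𝓝 (∑ i, ∑ j, |D.Cdot t i j|)) :=
    tendsto_finsetSum _ fun i _ => tendsto_finsetSum _ fun j _ => (hσt i j).abs
  have hSabs : Tendsto (fun r => ∑ i, ∑ j, |D.C t i j - D.C r i j|) (𝓝[<] t) (𝓝 0) := by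
    have h0 : ∀ i j, Tendsto (fun r => |D.C t i j - D.C r i j|) (𝓝[<] t) (𝓝 0) := by
      intro i j
      have h := ((D.hasDerivAt_C t ht.le i j).continuousAt.tendsto.const_sub (D.C t i j)).abs
      rw [sub_self, abs_zero] at h
      exact h.mono_left nhdsWithin_le_nhds
    have h := tendsto_finsetSum (Finset.univ : Finset (Fin N)) fun i _ =>
      tendsto_finsetSum (Finset.univ : Finset (Fin N)) fun j _ => h0 i j
    simpa using h
  -- the ε-argument
  rw [Metric.tendsto_nhds]
  intro ε₀ hε₀
  set T : ℝ := ∑ i, |D.Cdot t i i| + 1 with hT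
  have hT0 : 0 < T := by positivity
  have hTlt : ∑ i, D.Cdot t i i < T := by
    have : ∑ i, D.Cdot t i i ≤ ∑ i, |D.Cdot t i i| := Finset.sum_le_sum fun i _ => le_abs_self _
    linarith
  set ε₁ : ℝ := ε₀ / (4 * T) with hε₁
  have hε₁0 : 0 < ε₁ := by positivity
  obtain ⟨δ, hδ, hUCδ⟩ := exists_delta_of_uniformContinuous' (X := EuclideanSpace ℝ (Fin N))
    (Y := EuclideanSpace ℝ (Fin N) →L[ℝ] EuclideanSpace ℝ (Fin N) →L[ℝ] ℝ) hUC hε₁0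
  have hM0 : 0 ≤ M := le_trans (norm_nonneg (D2 φ)) (hM φ)
  have hK40 : 0 ≤ K4 := integral_nonneg fun z => by positivity
  have ev1 : ∀ᶠ r in 𝓝[<] t, dist ((1 / 2) * ∑ i, ∑ j, σ r i j * I i j) L < ε₀ / 4 :=
    Metric.tendsto_nhds.mp hA _ (by positivity)
  have ev2 : ∀ᶠ r in 𝓝[<] t, ∑ i, σ r i i < T := (tendsto_order.1 hdiag).2 T hTlt
  have ev3 : ∀ᶠ r in 𝓝[<] t,
      2 * M / δ ^ 2 * K4 * ((∑ i, ∑ j, |D.C t i j - D.C r i j|) * ∑ i, ∑ j, |σ r i j|) < ε₀ / 4 := by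
    have h := (hSabs.mul hσabs).const_mul (2 * M / δ ^ 2 * K4)
    rw [zero_mul, mul_zero] at h
    exact (tendsto_order.1 h).2 _ (by positivity)
  have ev4 : ∀ᶠ r in 𝓝[<] t, r ∈ Ioo 0 t := Ioo_mem_nhdsLT ht
  filter_upwards [ev1, ev2, ev3, ev4] with r hr1 hr2 hr3 hr4
  have hr0 : 0 ≤ r := hr4.1.le
  have hrt : r < t := hr4.2
  have hh : 0 < t - r := sub_pos.2 hrt
  -- the two-scale expansion: `C_∞ − C_r = (C_∞ − C_t) + (C_t − C_r)`, base `C_∞ − C_t`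
  have hE := abs_integral_add_sub_integral_sub_sum_le h1 h2 hG hM hUC hδ hUCδ
    (D.posSemidef_Cinf_sub ht.le) (D.posSemidef_C_sub hr0 hrt.le) φ
  rw [← Cinf_sub_eq_add D r t] at hE
  have hSσ : ∀ i j, (D.C t - D.C r) i j = (t - r) * σ r i j := by
    intro i j
    simp only [Matrix.sub_apply, hσ]
    have hne : r - t ≠ 0 := sub_ne_zero.2 hrt.ne
    field_simp
    ring
  have ha : ∑ i, (D.C t - D.C r) i i = (t - r) * ∑ i, σ r i i := by
    rw [Finset.mul_sum]; exact Finset.sum_congr rfl fun i _ => hSσ i i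
  have hb : ∑ i, ∑ j, |(D.C t - D.C r) i j| = (t - r) * ∑ i, ∑ j, |σ r i j| := by
    rw [Finset.mul_sum]
    refine Finset.sum_congr rfl fun i _ => ?_
    rw [Finset.mul_sum]
    refine Finset.sum_congr rfl fun j _ => ?_
    rw [hSσ, abs_mul, abs_of_pos hh]
  have hb' : ∑ i, ∑ j, |(D.C t - D.C r) i j| = ∑ i, ∑ j, |D.C t i j - D.C r i j| := by
    simp only [Matrix.sub_apply]
  have hquad : (1 / 2) * ∑ i, ∑ j, (D.C t - D.C r) i j * I i j =
      (t - r) * ((1 / 2) * ∑ i, ∑ j, σ r i j * I i j) := by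
    simp_rw [hSσ]
    rw [Finset.mul_sum, Finset.mul_sum, Finset.mul_sum]
    refine Finset.sum_congr rfl fun i _ => ?_
    rw [Finset.mul_sum, Finset.mul_sum, Finset.mul_sum]
    refine Finset.sum_congr rfl fun j _ => ?_
    ring
  -- assemble
  rw [slope_def_field, Real.dist_eq]
  set Δ := u r - u t - (1 / 2) * ∑ i, ∑ j, (D.C t - D.C r) i j * I i j with hΔ
  set A := (1 / 2) * ∑ i, ∑ j, σ r i j * I i j with hAdef
  have hq : (u r - u t) / (r - t) - -L = -(Δ / (t - r)) + (L - A) := by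
    have hne : r - t ≠ 0 := sub_ne_zero.2 hrt.ne
    have hne' : t - r ≠ 0 := hh.ne'
    rw [hΔ, hquad]
    field_simp
    ring
  have hΔle : |Δ| / (t - r) ≤ ε₁ * ∑ i, σ r i i +
      2 * M / δ ^ 2 * K4 * ((∑ i, ∑ j, |D.C t i j - D.C r i j|) * ∑ i, ∑ j, |σ r i j|) := by
    rw [div_le_iff₀ hh]
    have hE' : |Δ| ≤ ε₁ * ((t - r) * ∑ i, σ r i i) +
        2 * M / δ ^ 2 * (((t - r) * ∑ i, ∑ j, |σ r i j|) *
          (∑ i, ∑ j, |D.C t i j - D.C r i j|) * K4) := by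
      have h := hE
      rw [ha] at h
      calc |Δ| ≤ ε₁ * ((t - r) * ∑ i, σ r i i) +
            2 * M / δ ^ 2 * ((∑ i, ∑ j, |(D.C t - D.C r) i j|) ^ 2 * K4) := h
        _ = _ := by rw [pow_two, hb, ← hb, hb']; ring_nf
    calc |Δ| ≤ _ := hE'
      _ = _ := by ring
  have hA' : |L - A| < ε₀ / 4 := by rwa [Real.dist_eq, abs_sub_comm] at hr1
  calc |(u r - u t) / (r - t) - -L| = |-(Δ / (t - r)) + (L - A)| := by rw [hq]
    _ ≤ |-(Δ / (t - r))| + |L - A| := abs_add_le _ _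
    _ = |Δ| / (t - r) + |L - A| := by rw [abs_neg, abs_div, abs_of_pos hh]
    _ ≤ ε₁ * ∑ i, σ r i i +
        2 * M / δ ^ 2 * K4 * ((∑ i, ∑ j, |D.C t i j - D.C r i j|) * ∑ i, ∑ j, |σ r i j|) +
        |L - A| := by gcongr
    _ < ε₁ * T + ε₀ / 4 + ε₀ / 4 := by gcongr
    _ = ε₀ / 4 + ε₀ / 4 + ε₀ / 4 := by rw [hε₁]; field_simp
    _ < ε₀ := by linarith

/-- **The backward heat equation for the fluctuation covariance** ([BBD] Prop 5 applied to the
decreasing family `C_∞ − C_t`, the Gaussian ingredient of `−∂_t E_{ν_t} = E_{ν_t}L_t`, Prop 8): for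
`t > 0` and `G` bounded with bounded uniformly continuous Hessian,
`∂_t E_{C_∞−C_t}[G(φ+ζ)] = −½ Σ_{ij} Ċ_t^{ij} E_{C_∞−C_t}[∂_i∂_jG(φ+ζ)] = −½ E_{C_∞−C_t}[(Δ_{Ċ_t}G)(φ+ζ)]`,
for a covariance decomposition with possibly degenerate positive semidefinite `Ċ_t`.
-- TODO(general form): `t`-dependent integrands `e^{−V_t}F` (the full dual identity of Prop 8).
[cite: BauerschmidtBodineauDagallier2023, Proposition 5] -/
theorem hasDerivAt_integral_gaussian_Cinf_sub {G : EuclideanSpace ℝ (Fin N) → ℝ}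
    {D1 : EuclideanSpace ℝ (Fin N) → EuclideanSpace ℝ (Fin N) →L[ℝ] ℝ}
    {D2 : EuclideanSpace ℝ (Fin N) → EuclideanSpace ℝ (Fin N) →L[ℝ] EuclideanSpace ℝ (Fin N) →L[ℝ] ℝ}
    (h1 : ∀ x, HasFDerivAt G (D1 x) x) (h2 : ∀ x, HasFDerivAt D1 (D2 x) x)
    {K0 : ℝ} (hG : ∀ x, |G x| ≤ K0) {M : ℝ} (hM : ∀ x, ‖D2 x‖ ≤ M) (hUC : UniformContinuous D2)
    {t : ℝ} (ht : 0 < t) (φ : EuclideanSpace ℝ (Fin N)) :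
    HasDerivAt (fun s => ∫ x, G (φ + x) ∂(multivariateGaussian 0 (D.Cinf - D.C s)))
      (-((1 / 2) * ∑ i, ∑ j, D.Cdot t i j *
        ∫ x, D2 (φ + x) (EuclideanSpace.single i 1) (EuclideanSpace.single j 1)
          ∂(multivariateGaussian 0 (D.Cinf - D.C t)))) t := by
  have hl := hasDerivWithinAt_integral_gaussian_Cinf_sub_Iic D h1 h2 hG hM hUC ht φ
  have hr := hasDerivWithinAt_integral_gaussian_Cinf_sub_Ici D h1 h2 hG hM hUC ht.le φ
  have h := hl.union hr
  rw [Iic_union_Ici] at h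
  exact hasDerivWithinAt_univ.mp h

end Fluctuation

end Polchinski

end Literature.Analysis.FunctionSpaces

end
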